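import Mathlib
import HarnessLib

/-!
# The swap-distance form of the full acceptance curve (THEOREM Q♯♯ on all of `[½, 1]`), I:
# reduction to a block inequality

HONEST FRAMING. exact (Metropolis-corrected) sampling algorithms for lattice gauge theory; figures of
merit are autocorrelation/cost numbers at stated couplings and volumes; no continuum-physics claim.

Setting (pure real algebra, continuing `TrivializingMaps.AcceptanceCurveFourPoint`): two probability
vectors `x, y ≥ 0` on the four corners `{±1}²` (`Σ x = Σ y = 1`; `x` = target corner masses, `y` = the
model's); the independence-sampler mean acceptance of the pair is the sixteen-term sum
`S = Σ_{z,w} min (x_z y_w, x_w y_z)`, and `1 - S = Σ_{z<w} |x_z y_w - x_w y_z|` is the total-variation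
distance between `x ⊗ y` and its swap (`sixteen_sum_eq`).  `det x = x₊₊ x₋₋ - x₊₋ x₋₊`.

## What is proved (all `sorry`-free; NO definition is introduced)
* §2 `sixteen_sum_eq`, `swapDefect_ge_block`: `S = 1 - Σ_{z<w} |x_z y_w - x_w y_z|`, and, grouping the
  corners into the diagonal block `{++, --}` and the anti-diagonal block `{+-, -+}`,
  `1 - S ≥ L := |x(diag) - y(diag)| + |x₊₊ y₋₋ - x₋₋ y₊₊| + |x₊₋ y₋₊ - x₋₊ y₊₋|`.
* §3 (CONDITIONAL on the eight-variable BLOCK INEQUALITY, carried as the explicit hypothesis `hB` —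
  it is NOT proved in this file): `S ≥ ½ ⟹ |det x - det y| ≤ S (1 - S)`
  (`abs_det_sub_det_le_of_blockIneq`), i.e. `½ ≤ t ≤ S ⟹ (2t-1)² ≤ 1 - 4 |det x - det y|`
  (`curve_of_blockIneq`); for product models (`det y = 0`) this is clause (ii) of
  `AcceptanceCurveFourPoint.sum_min_curve` on the WHOLE range `t ∈ [½, 1]`, i.e. without its regime
  hypothesis `8/9 ≤ 4 |det x|` (`sum_min_curve_full_of_blockIneq`).
* The anti-aligned half of the block inequality is proved UNCONDITIONALLY in the companion file
  `TrivializingMaps.AcceptanceCurveSwapLower` (which imports this one).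

## NOT CLAIMED
The block inequality `hB` itself.  Its anti-aligned half is the companion file; its ALIGNED half
(`(x(diag) - y(diag)) · (det x - det y) > 0`), hence the unconditional full curve, is numerically
certified only (> 4·10⁶ samples; equality cases `x = (λ,0,0,1-λ), y = δ₋₋`, and
`x(diag) - y(diag) = ½` with uniform block conditionals); its proof architecture (concave
interpolation in the block couplings, two of the three vertex families certified by explicit
sum-of-squares identities) is recorded in the cell's THEORY-1.md §35, not formalised.  Nothing about
lattice gauge theory proper.

References: tree THEOREM Q (`AcceptanceFootprint`, `AcceptanceFootprintSharp/Floor`),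
`AcceptanceCurveFourPoint` (rows 94–95 of the cell); M. Lüscher, CMP 293 (2010)
[Luscher2010Trivializing] (context only).
-/

namespace Summit.Ventures.LatticeQCDFlow.TrivializingMaps.Curve

/-! ## §1. The block inequality (hypothesis `hB` of §3; no definition is introduced)

Corner masses of `x` on the diagonal block `a = x₊₊, b = x₋₋` and on the anti-diagonal block
`e = x₊₋, f = x₋₊`; of `y`: `c = y₊₊, d = y₋₋, g = y₊₋, h = y₋₊`.  With the block lower bound
`L = |a + b - c - d| + |a d - b c| + |e h - f g|` of the swap distance, the BLOCK INEQUALITY reads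
`L ≤ ½ ⟹ |(a b - e f) - (c d - g h)| ≤ L (1 - L)`.  It is numerically certified and NOT proved here;
the theorems of §3 carry it as the explicit hypothesis `hB` (section variable, `include hB`). -/

/-! ## §2. The sixteen-term sum is one minus the swap distance -/

/-- `2 min p q = p + q - |p - q|`. -/
theorem two_mul_min_eq (p q : ℝ) : 2 * min p q = p + q - |p - q| := by
  rcases le_total p q with h | h
  · rw [min_eq_left h, abs_of_nonpos (sub_nonpos.2 h)]; ring
  · rw [min_eq_right h, abs_of_nonneg (sub_nonneg.2 h)]; ring

/-- `S = 1 - Σ_{z<w} |x_z y_w - x_w y_z|` for probability vectors `x, y` on `{±1}²`. -/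
theorem sixteen_sum_eq (x y : Bool × Bool → ℝ)
    (hxs : x (true, true) + x (true, false) + x (false, true) + x (false, false) = 1)
    (hys : y (true, true) + y (true, false) + y (false, true) + y (false, false) = 1) :
    ∑ z : Bool × Bool, ∑ w : Bool × Bool, min (x z * y w) (x w * y z)
      = 1 - (|x (true, true) * y (false, false) - x (false, false) * y (true, true)|
              + |x (true, false) * y (false, true) - x (false, true) * y (true, false)|
              + |x (true, true) * y (true, false) - x (true, false) * y (true, true)|
              + |x (true, true) * y (false, true) - x (false, true) * y (true, true)|
              + |x (false, false) * y (true, false) - x (true, false) * y (false, false)|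
              + |x (false, false) * y (false, true) - x (false, true) * y (false, false)|) := by
  simp only [Fintype.sum_prod_type, Fintype.sum_bool, min_self]
  have h1 := two_mul_min_eq (x (true, true) * y (false, false)) (x (false, false) * y (true, true))
  have h2 := two_mul_min_eq (x (true, false) * y (false, true)) (x (false, true) * y (true, false))
  have h3 := two_mul_min_eq (x (true, true) * y (true, false)) (x (true, false) * y (true, true))
  have h4 := two_mul_min_eq (x (true, true) * y (false, true)) (x (false, true) * y (true, true))
  have h5 := two_mul_min_eq (x (false, false) * y (true, false)) (x (true, false) * y (false, false))
  have h6 := two_mul_min_eq (x (false, false) * y (false, true)) (x (false, true) * y (false, false))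
  rw [min_comm (x (false, false) * y (true, true)), min_comm (x (false, true) * y (true, false)),
    min_comm (x (true, false) * y (true, true)), min_comm (x (false, true) * y (true, true)),
    min_comm (x (true, false) * y (false, false)), min_comm (x (false, true) * y (false, false))]
  have hone : (x (true, true) + x (true, false) + x (false, true) + x (false, false))
      * (y (true, true) + y (true, false) + y (false, true) + y (false, false)) = 1 := by
    rw [hxs, hys]; norm_num
  nlinarith [h1, h2, h3, h4, h5, h6, hone]

/-- **Block lower bound of the swap distance.**  `1 - S ≥ |x(diag) - y(diag)| + |x₊₊ y₋₋ - x₋₋ y₊₊|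
+ |x₊₋ y₋₊ - x₋₊ y₊₋|`. -/
theorem swapDefect_ge_block (x y : Bool × Bool → ℝ)
    (hxs : x (true, true) + x (true, false) + x (false, true) + x (false, false) = 1)
    (hys : y (true, true) + y (true, false) + y (false, true) + y (false, false) = 1) :
    |x (true, true) + x (false, false) - y (true, true) - y (false, false)|
        + |x (true, true) * y (false, false) - x (false, false) * y (true, true)|
        + |x (true, false) * y (false, true) - x (false, true) * y (true, false)|
      ≤ 1 - ∑ z : Bool × Bool, ∑ w : Bool × Bool, min (x z * y w) (x w * y z) := by
  rw [sixteen_sum_eq x y hxs hys]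
  have hτ : x (true, true) + x (false, false) - y (true, true) - y (false, false)
      = (x (true, true) * y (true, false) - x (true, false) * y (true, true))
        + (x (true, true) * y (false, true) - x (false, true) * y (true, true))
        + (x (false, false) * y (true, false) - x (true, false) * y (false, false))
        + (x (false, false) * y (false, true) - x (false, true) * y (false, false)) := by
    linear_combination (y (true, true) + y (false, false)) * hxs
      - (x (true, true) + x (false, false)) * hys
  have hcross : |x (true, true) + x (false, false) - y (true, true) - y (false, false)|
      ≤ |x (true, true) * y (true, false) - x (true, false) * y (true, true)|
        + |x (true, true) * y (false, true) - x (false, true) * y (true, true)|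
        + |x (false, false) * y (true, false) - x (true, false) * y (false, false)|
        + |x (false, false) * y (false, true) - x (false, true) * y (false, false)| := by
    rw [hτ]
    have e1 := abs_add_le
      ((x (true, true) * y (true, false) - x (true, false) * y (true, true))
        + (x (true, true) * y (false, true) - x (false, true) * y (true, true))
        + (x (false, false) * y (true, false) - x (true, false) * y (false, false)))
      (x (false, false) * y (false, true) - x (false, true) * y (false, false))
    have e2 := abs_add_le
      ((x (true, true) * y (true, false) - x (true, false) * y (true, true))
        + (x (true, true) * y (false, true) - x (false, true) * y (true, true)))
      (x (false, false) * y (true, false) - x (true, false) * y (false, false))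
    have e3 := abs_add_le
      (x (true, true) * y (true, false) - x (true, false) * y (true, true))
      (x (true, true) * y (false, true) - x (false, true) * y (true, true))
    linarith
  linarith

/-! ## §3. The curve from the block inequality -/

section Block

variable
  (hB : ∀ a b c d e f g h : ℝ, 0 ≤ a → 0 ≤ b → 0 ≤ c → 0 ≤ d → 0 ≤ e → 0 ≤ f → 0 ≤ g → 0 ≤ h →
    a + b + e + f = 1 → c + d + g + h = 1 →
    |a + b - c - d| + |a * d - b * c| + |e * h - f * g| ≤ 1 / 2 →
    |(a * b - e * f) - (c * d - g * h)|
      ≤ (|a + b - c - d| + |a * d - b * c| + |e * h - f * g|)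
          * (1 - (|a + b - c - d| + |a * d - b * c| + |e * h - f * g|)))

include hB

/-- **`|det x - det y| ≤ S (1 - S)` whenever `S ≥ ½`, conditional on the block inequality `hB`.** -/
theorem abs_det_sub_det_le_of_blockIneq (x y : Bool × Bool → ℝ)
    (hx0 : ∀ z, 0 ≤ x z) (hy0 : ∀ z, 0 ≤ y z)
    (hxs : x (true, true) + x (true, false) + x (false, true) + x (false, false) = 1)
    (hys : y (true, true) + y (true, false) + y (false, true) + y (false, false) = 1)
    (hS : 1 / 2 ≤ ∑ z : Bool × Bool, ∑ w : Bool × Bool, min (x z * y w) (x w * y z)) :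
    |(x (true, true) * x (false, false) - x (true, false) * x (false, true))
        - (y (true, true) * y (false, false) - y (true, false) * y (false, true))|
      ≤ (∑ z : Bool × Bool, ∑ w : Bool × Bool, min (x z * y w) (x w * y z))
          * (1 - ∑ z : Bool × Bool, ∑ w : Bool × Bool, min (x z * y w) (x w * y z)) := by
  set S := ∑ z : Bool × Bool, ∑ w : Bool × Bool, min (x z * y w) (x w * y z) with hSdef
  have hblk := swapDefect_ge_block x y hxs hys
  rw [← hSdef] at hblk
  set L := |x (true, true) + x (false, false) - y (true, true) - y (false, false)|
        + |x (true, true) * y (false, false) - x (false, false) * y (true, true)|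
        + |x (true, false) * y (false, true) - x (false, true) * y (true, false)| with hLdef
  have hL0 : 0 ≤ L := by positivity
  have hLhalf : L ≤ 1 / 2 := by linarith
  have hmain := hB (x (true, true)) (x (false, false)) (y (true, true)) (y (false, false))
    (x (true, false)) (x (false, true)) (y (true, false)) (y (false, true))
    (hx0 _) (hx0 _) (hy0 _) (hy0 _) (hx0 _) (hx0 _) (hy0 _) (hy0 _)
    (by linarith) (by linarith)
  have hτ : x (true, true) + x (false, false) - y (true, true) - y (false, false)
      = x (true, true) + x (false, false) - (y (true, true)) - (y (false, false)) := rfl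
  have hL' : |x (true, true) + x (false, false) - y (true, true) - y (false, false)|
        + |x (true, true) * y (false, false) - x (false, false) * y (true, true)|
        + |x (true, false) * y (false, true) - x (false, true) * y (true, false)| = L := rfl
  rw [hL'] at hmain
  have hmono : L * (1 - L) ≤ S * (1 - S) := by nlinarith
  exact (hmain hLhalf).trans hmono

/-- **The full curve, conditional on the block inequality `hB`:** `½ ≤ t ≤ S ⟹ (2 t - 1)² ≤ 1 - 4 |det x - det y|`. -/
theorem curve_of_blockIneq (x y : Bool × Bool → ℝ)
    (hx0 : ∀ z, 0 ≤ x z) (hy0 : ∀ z, 0 ≤ y z)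
    (hxs : x (true, true) + x (true, false) + x (false, true) + x (false, false) = 1)
    (hys : y (true, true) + y (true, false) + y (false, true) + y (false, false) = 1) {t : ℝ}
    (ht : t ≤ ∑ z : Bool × Bool, ∑ w : Bool × Bool, min (x z * y w) (x w * y z)) (ht2 : 1 / 2 ≤ t) :
    (2 * t - 1) ^ 2 ≤ 1 - 4 * |(x (true, true) * x (false, false) - x (true, false) * x (false, true))
        - (y (true, true) * y (false, false) - y (true, false) * y (false, true))| := by
  have h := abs_det_sub_det_le_of_blockIneq hB x y hx0 hy0 hxs hys (ht2.trans ht)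
  set S := ∑ z : Bool × Bool, ∑ w : Bool × Bool, min (x z * y w) (x w * y z)
  have hS1 : S ≤ 1 := by
    have := swapDefect_ge_block x y hxs hys
    have h0 : 0 ≤ |x (true, true) + x (false, false) - y (true, true) - y (false, false)|
        + |x (true, true) * y (false, false) - x (false, false) * y (true, true)|
        + |x (true, false) * y (false, true) - x (false, true) * y (true, false)| := by positivity
    linarith
  nlinarith

/-- **Product models (clause (ii) of `sum_min_curve` on the whole of `[½, 1]`, conditional on
the block inequality `hB`).**  Target masses `x ≥ 0`, `Σ x = 1`, product model with marginals `(p', 1-p') ⊗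
(q', 1-q')`, `½ ≤ t ≤` the sixteen-term mean acceptance: `(2 t - 1)² ≤ 1 - 4 |x₊₊ x₋₋ - x₊₋ x₋₊|`. -/
theorem sum_min_curve_full_of_blockIneq (x : Bool × Bool → ℝ) {p' q' t : ℝ}
    (hx0 : ∀ z, 0 ≤ x z)
    (hs : x (true, true) + x (true, false) + x (false, true) + x (false, false) = 1) (hp0 : 0 ≤ p')
    (hp1 : p' ≤ 1) (hq0 : 0 ≤ q') (hq1 : q' ≤ 1)
    (ht : t ≤ ∑ z : Bool × Bool, ∑ w : Bool × Bool,
        min (x z * ((if w.1 then p' else 1 - p') * (if w.2 then q' else 1 - q')))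
          (x w * ((if z.1 then p' else 1 - p') * (if z.2 then q' else 1 - q'))))
    (ht2 : 1 / 2 ≤ t) :
    (2 * t - 1) ^ 2 ≤ 1 - 4 * |x (true, true) * x (false, false) - x (true, false) * x (false, true)| := by
  set y : Bool × Bool → ℝ := fun w => (if w.1 then p' else 1 - p') * (if w.2 then q' else 1 - q')
    with hydef
  have hy0 : ∀ z, 0 ≤ y z := by
    rintro ⟨i, j⟩; cases i <;> cases j <;> simp [hydef] <;> nlinarith
  have hys : y (true, true) + y (true, false) + y (false, true) + y (false, false) = 1 := by
    simp [hydef]; ring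
  have hdet : y (true, true) * y (false, false) - y (true, false) * y (false, true) = 0 := by
    simp [hydef]; ring
  have h := curve_of_blockIneq hB x y hx0 hy0 hs hys (t := t) (by simpa [hydef] using ht) ht2
  simpa [hdet] using h

end Block

end Summit.Ventures.LatticeQCDFlow.TrivializingMaps.Curve
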